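/-
Copyright (c) 2026 the pub-hodgecm-mathlib formalisation cell (harness21).  Prover seat hodgecm-mathlib-LH7-p09 (g3), CLOSE-OUT ROSTER strike line L3∕L5 (Track A
«(D-RAM) FOUR-FRAME» squad F0∕P3c∕LH4 ∕ F0∕P3c∕LH7); β₂ WORDs #34∕#36 «THE MIX-HI WALL» (lead LH4-p13 (g10), second LH7-p09 (g3)); helper lane on h413 =
stmt-HodgeConjecture-24833 (count-neutral).  2026-09-05.
-/
import Summits.HodgeConjecture.HodgeConjecture.Theorems.F0P3cDyRamLowerLineFlipFace                    -- ★ p863923 (LH7-p09 (g2)): `exists_glueLetters_of_gen`; brings ★ p863761, ★ p862869, ★ `…ConeCellFaceAxis`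
import Summits.HodgeConjecture.HodgeConjecture.Theorems.F0P3cDyRamConeCellGluedVertexExistsOfWeight     -- ★ p864081 (LH7-p10 (g3)): «populated ⇒ glued»; brings ★ `…ConeCellFaceTube`
import Summits.HodgeConjecture.HodgeConjecture.Theorems.F0P3cDyRamConeCellFaceTubeAbove                 -- ★ p861237 (LH4-p16 (g0)): the `d ≤ b` frame; brings ★ Lit `natCard_normFibre_eq_zero_of_not_exists_of_le`
import HarnessLib

/-!
# Crux `H413`, line LH4 «(D-RAM) FOUR-FRAME» — STAGE-1b, row (2) of `f_{T₊}`, the (β₂) road (R-36), the MIX-HI WALL (β₂ WORDs #34∕#36): «THE PRODUCT READ OF A LOWER-LINE CELL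
# AT AND ABOVE THE GLUE CONDUCTOR» — on a populated member of a lower-line cell `(j, b)` with `d ≤ b`, a glued vertex is `+`-labelled IFF the PRODUCT CLASS (glue unit × ray scalar)
# of the member is the norm class; and that product class is invariant under every exact flip `x₀ ↦ z·x₀` (`z·Θz = jE ξ₀`, `ξ₀` a `σ`-fixed unit)

Cell `hodgecm-mathlib` (D-0151), FLOOR 0, crux item H413 = `stmt-HodgeConjecture-24833`, route of record `HCCMUnconditional`; squads F0∕P3c∕LH4 ∕ LH7; lane
`--supports stmt-HodgeConjecture-24833 --as helper` (count-neutral; pays NO tier-0 row).  THEOREMS ONLY (no `def`, no instance, no notation, no `sorry`, default heartbeats);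
★-only imports; states NO law; (β₂) and the MIX-HI letters stay HYPOTHESES.  Frame of §2 = ★ p863923 `face_of_line_of_succ_le`'s (junction frame, E-side wild datum, the lower-line
letters `hμle hanti g1 g2 g3 gsk hlamn hun` in the cell currency `cc = ϖE^j`) with `hdb : d ≤ b` in place of `b + 1 ≤ d`, + ★ (C1)'s weight letter `hf`.

THE PRODUCT CLASS `Pc Λ` (a bound predicate with its defining `Iff`, `hPc`; no `def`): «SOME presentation `x₀` of `Λ` (order ∕ primitivity ∕ level clauses) carries a `σ`-fixed unit
`r` with `jE r = glueUnit(x₀, b)`, a ray scalar `e₀` (`jE e₀ = Tr_ρ(μ ∕ (cc·(α − ρα)·ΘY(x₀)))`, `μ = lam − jE u₀₀`) and a `σ`-fixed unit `e′` with `|e₀ − e′·t₊| ≤ |ϖ|^{m*}`, such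
that `r·e′ ∈ N(E^×)`».  (On the lower line both classes are functions of the member; the product is the one character β₂ WORD #36 counts.)
* §1 `prodClass_smul_iff` — FLIP LETTER: for `z·Θz = jE ξ₀` with `ξ₀` a `σ`-fixed UNIT (norm or not), `Pc (z • Λ) ↔ Pc Λ` for EVERY `Λ` (`r ↦ r∕ξ₀`, `e₀ ↦ e₀∕ξ₀`, `e′ ↦ e′∕ξ₀`,
  `r·e′ ↦ r·e′∕ξ₀²`; ★ `glueUnit_mul_left`, ★ `dualGen_mul_left`).  Datum-light (no cell, no completeness).
* §2 HEAD `valueSet_eq_plus_iff_prodClass_of_weight_ne_zero` — THE READ: for a member `Λ` of `levelSetDep(j, b; μ)` with glue weight `f b j Λ ≠ 0` and ANY glued self-dual vertex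
  `L₃` over it (`φ(B) = Λ`, `L₃ ∩ W = ι_W B`, tube `b`), `VS_{m*}(Γ − 1 ∣ L₃) = valueSetMod σ ϖ m* X₊ ↔ Pc Λ` (→: the canonical datum ★ `exists_fixed_unit_weight_eq_natCard_normFibre` is a
  norm since `f ≠ 0` at `d ≤ b` (★ Lit `natCard_normFibre_eq_zero_of_not_exists_of_le`), its ray unit ★ p863761 is a norm by the class dictionary ★ p861154; ←: the witness's `r` is
  a norm by ★ (C1)'s `hf` at the witness's own presentation, hence `e′` is, and the vertex's ray unit on that presentation is congruent to `e′` at level `2d − 1` (★ p861900 (S0″))).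
* The two READS of ★ `…ConeCellProductSocket.cellDiff_eq_zero_of_flip_of_prodBalance` for the SHELL-FREE literals of ★ p863399 (`(∃ glued L₃, VS = V₊) ↔ Pc Λ`,
  `(∃ glued L₃, ¬ VS = V₊) ↔ ¬ Pc Λ` on populated members) follow from §2 and ★ p864081 «populated ⇒ glued» inside the consumer's opened frame; not restated here.
HONEST LABEL.  Count-neutral composition; nothing printed is asserted; no census law is stated; ‹PRODBAL-L› (the balance of `Pc` over the cell) and the MIX-HI letters stay OPEN;
`HC_CM` is proved only modulo the 7 printed citations (2 remaining named inputs: hLiu418 = `stmt-HodgeConjecture-24832`, h413 = `stmt-HodgeConjecture-24833`) until rung 0 closes.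
## References
* [Rogawski1990] J. D. Rogawski, *Automorphic Representations of Unitary Groups in Three Variables*, Ann. of Math. Stud. 123 (1990): §4.9 Prop. 4.9.1 (b) p. 55.
* [Jacobowitz1962] R. Jacobowitz, *Hermitian forms over local fields*, Amer. J. Math. 84 (1962): §4 (duals, gluing, the glue unit).
* [Serre1979] J.-P. Serre, *Local Fields*, GTM 67 (1979): Ch. V §3 Prop. 5, Cor. 2–3 pp. 84–86 (norm classes of units); Ch. III §6 Prop. 12.
* [LabesseLanglands1979] J.-P. Labesse, R. P. Langlands, *L-indistinguishability for SL(2)*, Canad. J. Math. 31 (1979): §2 p. 8.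
* [Kottwitz1986BaseChangeUnits] R. E. Kottwitz, *Base change for unit elements of Hecke algebras*, Compositio Math. 60 (1986): §1 pp. 240–241.
-/

set_option autoImplicit false

noncomputable section

namespace Summit.HodgeConjecture.HodgeConjecture.Cruxes.H413.F0P3cDyRamLowerMixHiProductRead

open scoped Valued WithZero Matrix MatrixGroups Pointwise
open WithZero
open Literature.NumberTheory.Automorphic Literature.NumberTheory.Automorphic.HermitianLattice Literature.NumberTheory.Automorphic.UnitaryLatticeTree
open Literature.NumberTheory.Automorphic.UnitaryThreeFourFrame (IsRamifiedQuadraticDatum)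
open Literature.NumberTheory.Automorphic.EllipticPlaneAsFieldLine
open Literature.NumberTheory.Rogawski1990
open Literature.NumberTheory.LocalFields.WildQuadraticDatum (natCard_normFibre_eq_zero_of_not_exists_of_le)
open Summit.HodgeConjecture.HodgeConjecture.Cruxes.H413.F0P3cDyRamFourFramePieces
open Summit.HodgeConjecture.HodgeConjecture.Cruxes.H413.F0P3cDyRamToricCensusDefs
open Summit.HodgeConjecture.HodgeConjecture.Cruxes.H413.F0P3cDyRamConeCellFaceAxis (valueSetMod_smul_xPlus_eq_plus_iff_exists_norm)
open Summit.HodgeConjecture.HodgeConjecture.Cruxes.H413.F0P3cDyRamLabelShellFlipCardTwo (v_refSkew_eq valueSetMod_smul_xPlus_eq_of_v_sub_le_pred)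
open Summit.HodgeConjecture.HodgeConjecture.Cruxes.H413.F0P3cDyRamBoundaryCellLetterCardTwo (v_map_lt_one_iff_of_le_iff)
open Summit.HodgeConjecture.HodgeConjecture.Cruxes.H413.F0P3cDyRamConeWeightHalfSplit (dualGen_mul_left isOrd_mul_left_iff_of_fixed_unit glueUnit_mul_left)
open Summit.HodgeConjecture.HodgeConjecture.Cruxes.H413.F0P3cDyRamConeCellFaceTube (exists_fixed_unit_weight_eq_natCard_normFibre)
open Summit.HodgeConjecture.HodgeConjecture.Cruxes.H413.F0P3cDyRamLowerLineVertexRay (exists_fixed_unit_valueSet_eq_smul_xPlus_of_line_sizes)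
open Summit.HodgeConjecture.HodgeConjecture.Cruxes.H413.F0P3cDyRamLowerLineFlipFace (exists_glueLetters_of_gen)
open Summit.HodgeConjecture.HodgeConjecture.Cruxes.H413.F0P3cDyRamConeCellGluedVertexExistsOfWeight (exists_glued_of_mem_levelSetDep_of_weight_ne_zero)

variable {E M : Type} [Field E] [Valued E ℤᵐ⁰] [Field M] [Valued M ℤᵐ⁰] {ρ Θ : M →+* M} {α : M}

/-! ## §1 The flip letter of the product class -/

/-- **FLIP LETTER — THE PRODUCT CLASS IS INVARIANT UNDER EVERY EXACT FLIP.**  `Pc` = the product-class predicate of the header (its defining `Iff` is `hPc`; letters `jE ϖ^j`, `h`,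
`jE hW`, `b`, `μ`, `t₊`); for `z·Θz = jE ξ₀` with `σξ₀ = ξ₀`, `|ξ₀| = 1` (`Θ` an involution, `Fix ρ = jE(E)`, `jE` isometric, `|ϖ| = exp(−1)`): `Pc (z • Λ) ↔ Pc Λ` for every
additive subgroup `Λ` — the witness `(x₀, r, e₀, e′)` goes to `(z·x₀, r∕ξ₀, e₀∕ξ₀, e′∕ξ₀)` (★ `dualGen_mul_left`, ★ `glueUnit_mul_left`), and `r·e′ ↦ r·e′∕ξ₀²` keeps the norm class.
[cite: Jacobowitz1962, §4] [cite: Serre1979, Ch. V §3 Cor. 3] -/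
theorem prodClass_smul_iff {σ : E →+* E} {ϖ : E} (hϖ : Valued.v ϖ = exp (-1 : ℤ)) (jE : E →+* M)
    (hjiso : ∀ c, Valued.v (jE c) = Valued.v c) (hjfix : ∀ z, ρ z = z ↔ ∃ c, jE c = z) (hΘj : ∀ c, Θ (jE c) = jE (σ c))
    (hΘΘ : ∀ x, Θ (Θ x) = x) (h : M) (hW : E) (j b d : ℕ) (μ : M)
    (Pc : AddSubgroup M → Prop)
    (hPc : ∀ Λ, Pc Λ ↔ ∃ (x₀ : M) (r e₀ e' : E), x₀ ≠ 0 ∧ (∀ x, x ∈ Λ ↔ ∃ ζ, IsOrd ρ α (jE ϖ ^ j) ζ ∧ x = x₀ * ζ) ∧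
      IsOrd ρ α (jE ϖ ^ j) (dualGen ρ Θ α (jE ϖ ^ j) h x₀) ∧ ¬ IsOrd ρ α (jE ϖ ^ j) (dualGen ρ Θ α (jE ϖ ^ j) h x₀ / jE ϖ) ∧
      Valued.v (dualGen ρ Θ α (jE ϖ ^ j) h x₀) = Valued.v (jE ϖ) ^ b ∧
      σ r = r ∧ Valued.v r = 1 ∧ jE r = glueUnit ρ Θ α (jE ϖ ^ j) h (jE ϖ) (jE hW) x₀ b ∧
      jE e₀ = μ / (jE ϖ ^ j * (α - ρ α) * Θ (dualGen ρ Θ α (jE ϖ ^ j) h x₀)) + ρ (μ / (jE ϖ ^ j * (α - ρ α) * Θ (dualGen ρ Θ α (jE ϖ ^ j) h x₀))) ∧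
      σ e' = e' ∧ Valued.v e' = 1 ∧ Valued.v (e₀ - e' * ((ϖ - σ ϖ) * ((ϖ * σ ϖ) ^ ((d - d % 2) / 2))⁻¹)) ≤ Valued.v ϖ ^ mstarOfRecord d ∧
      ∃ c : E, c * σ c = r * e')
    {z : M} {ξ₀ : E} (hz : z * Θ z = jE ξ₀) (hσξ : σ ξ₀ = ξ₀) (hξ1 : Valued.v ξ₀ = 1) (Λ : AddSubgroup M) :
    Pc (z • Λ) ↔ Pc Λ := by
  -- one direction for any flip data `(z', ξ')`
  have key : ∀ (z' : M) (ξ' : E), z' * Θ z' = jE ξ' → σ ξ' = ξ' → Valued.v ξ' = 1 → ∀ Λ' : AddSubgroup M, Pc Λ' → Pc (z' • Λ') := by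
    intro z' ξ' hz' hσξ' hξ'1 Λ' hP
    have hρj : ρ (jE ξ') = jE ξ' := (hjfix _).2 ⟨ξ', rfl⟩
    have hj1 : Valued.v (jE ξ') = 1 := by rw [hjiso, hξ'1]
    have hj0 : jE ξ' ≠ 0 := fun h0 => by rw [h0, map_zero] at hj1; exact zero_ne_one hj1
    have hξ'0 : ξ' ≠ 0 := fun h0 => hj0 (by rw [h0, map_zero])
    have hz'0 : z' ≠ 0 := fun h0 => hj0 (by rw [← hz', h0, zero_mul])
    have hΘjξ : Θ (jE ξ') = jE ξ' := by rw [hΘj, hσξ']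
    obtain ⟨x₀, r, e₀, e', hx₀, hΛx, hyO, hyp, hylev, hσr, hr1, hr, he₀, hσe', he'1, hclose, c, hc⟩ := (hPc Λ').1 hP
    have hY : dualGen ρ Θ α (jE ϖ ^ j) h (z' * x₀) = jE ξ' * dualGen ρ Θ α (jE ϖ ^ j) h x₀ := dualGen_mul_left hz' (jE ϖ ^ j) h x₀
    have hY0 : dualGen ρ Θ α (jE ϖ ^ j) h x₀ ≠ 0 := by
      intro h0
      rw [h0, map_zero] at hylev
      have hϖ0 : Valued.v (jE ϖ) ≠ 0 := by rw [hjiso, hϖ]; exact exp_ne_zero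
      exact pow_ne_zero b hϖ0 hylev.symm
    refine (hPc (z' • Λ')).2 ⟨z' * x₀, r * ξ'⁻¹, e₀ * ξ'⁻¹, e' * ξ'⁻¹, mul_ne_zero hz'0 hx₀, fun x => ?_, ?_, ?_, ?_, ?_, ?_, ?_, ?_, ?_, ?_, ?_, c * ξ'⁻¹, ?_⟩
    · rw [AddSubgroup.mem_smul_pointwise_iff_exists]
      constructor
      · rintro ⟨y, hy, rfl⟩
        obtain ⟨ζ, hζ, rfl⟩ := (hΛx y).1 hy
        exact ⟨ζ, hζ, by rw [smul_eq_mul, mul_assoc]⟩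
      · rintro ⟨ζ, hζ, rfl⟩
        exact ⟨x₀ * ζ, (hΛx _).2 ⟨ζ, hζ, rfl⟩, by rw [smul_eq_mul, mul_assoc]⟩
    · rw [hY]; exact (isOrd_mul_left_iff_of_fixed_unit hρj hj1 (jE ϖ ^ j) _).2 hyO
    · rw [hY, mul_div_assoc, isOrd_mul_left_iff_of_fixed_unit hρj hj1 (jE ϖ ^ j)]; exact hyp
    · rw [hY, Valuation.map_mul, hj1, one_mul, hylev]
    · rw [map_mul, map_inv₀, hσr, hσξ']
    · rw [Valuation.map_mul, map_inv₀, hr1, hξ'1, inv_one, mul_one]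
    · rw [map_mul, map_inv₀, hr, glueUnit_mul_left hΘΘ hz' hρj hj0 hY0 (jE ϖ) (jE hW) b, div_eq_mul_inv]
    · rw [map_mul, map_inv₀, he₀, hY, map_mul Θ, hΘjξ,
        show μ / (jE ϖ ^ j * (α - ρ α) * (jE ξ' * Θ (dualGen ρ Θ α (jE ϖ ^ j) h x₀))) =
          μ / (jE ϖ ^ j * (α - ρ α) * Θ (dualGen ρ Θ α (jE ϖ ^ j) h x₀)) * (jE ξ')⁻¹ by rw [div_mul_eq_div_mul_one_div]; field_simp,
        map_mul ρ, map_inv₀ ρ, hρj, add_mul]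
    · rw [map_mul, map_inv₀, hσe', hσξ']
    · rw [Valuation.map_mul, map_inv₀, he'1, hξ'1, inv_one, mul_one]
    · rw [show e₀ * ξ'⁻¹ - e' * ξ'⁻¹ * ((ϖ - σ ϖ) * ((ϖ * σ ϖ) ^ ((d - d % 2) / 2))⁻¹) =
          (e₀ - e' * ((ϖ - σ ϖ) * ((ϖ * σ ϖ) ^ ((d - d % 2) / 2))⁻¹)) * ξ'⁻¹ by ring,
        Valuation.map_mul, map_inv₀, hξ'1, inv_one, mul_one]
      exact hclose
    · rw [map_mul, map_inv₀, hσξ', show c * ξ'⁻¹ * (σ c * ξ'⁻¹) = (c * σ c) * ξ'⁻¹ * ξ'⁻¹ by ring, hc]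
      ring
  refine ⟨fun hP => ?_, key z ξ₀ hz hσξ hξ1 Λ⟩
  -- the inverse flip
  have hj1 : Valued.v (jE ξ₀) = 1 := by rw [hjiso, hξ1]
  have hj0 : jE ξ₀ ≠ 0 := fun h0 => by rw [h0, map_zero] at hj1; exact zero_ne_one hj1
  have hz0 : z ≠ 0 := fun h0 => hj0 (by rw [← hz, h0, zero_mul])
  have hzi : z⁻¹ * Θ z⁻¹ = jE ξ₀⁻¹ := by rw [map_inv₀, ← mul_inv, hz, map_inv₀]
  have h' := key z⁻¹ ξ₀⁻¹ hzi (by rw [map_inv₀, hσξ]) (by rw [map_inv₀, hξ1, inv_one]) (z • Λ) hP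
  rwa [smul_smul, inv_mul_cancel₀ hz0, one_smul] at h'

/-! ## §2 HEAD — the product read of a populated lower-line member at and above the glue conductor -/

/-- **HEAD — «ON A POPULATED LOWER-LINE MEMBER AT AND ABOVE THE GLUE CONDUCTOR, A GLUED VERTEX IS `+`-LABELLED IFF THE PRODUCT CLASS IS THE NORM CLASS».**  Junction frame
(block `(H₂, h_W)`, ★ (C1)'s line model, `jE` isometric, `Θ ∘ jE = jE ∘ σ`), E-side wild datum, the literal's `u : GL (Fin 1) E` (`u₀₀·σu₀₀ = 1`), `Θlam·lam = 1`, `|lam| = 1`; the cell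
`(j, b)` with `1 ≤ b < j`, `d ≤ b`, `lam ∈ 𝒪_j`; the LOWER-LINE letters `hμle hanti g1 g2 g3 gsk hlamn hun` (as in ★ p863923); ★ (C1)'s weight letter `hf`; the product-class
predicate `Pc` with its defining `Iff`.  THEN for every member `Λ` of `levelSetDep(j, b; lam − jE u₀₀)` with `f b j Λ ≠ 0` and every glued self-dual vertex `L₃` over it:
`VS_{m*}(Γ − 1 ∣ L₃) = valueSetMod σ ϖ (mstarOfRecord d) (xPlus σ ϖ d) ↔ Pc Λ`. [cite: Rogawski1990, §4.9 Prop. 4.9.1 (b) p. 55] [cite: Serre1979, Ch. V §3 Prop. 5, Cor. 2–3 pp. 84–86]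
[cite: Jacobowitz1962, §4] [cite: LabesseLanglands1979, §2 p. 8] [cite: Kottwitz1986BaseChangeUnits, §1 pp. 240–241] -/
theorem valueSet_eq_plus_iff_prodClass_of_weight_ne_zero [CompleteSpace E] [IsDiscreteValuationRing 𝒪[E]] [Finite 𝓀[E]]
    (σ : E →+* E) (hσ : ∀ a, σ (σ a) = a) (hvσ : ∀ a, Valued.v (σ a) = Valued.v a) {ϖ : E} (hϖ : Valued.v ϖ = exp (-1 : ℤ))
    {d t : ℕ} (hD : IsRamifiedQuadraticDatum σ ϖ d t)
    {H₂ : Matrix (Fin 2) (Fin 2) E} (hH₂ : IsUnit H₂.det) (hH₂σ : (H₂.map σ)ᵀ = H₂) {hW : E} (hhW : Valued.v hW = 1) (hhWσ : σ hW = hW)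
    (jE : E →+* M) (hρρ : ∀ x, ρ (ρ x) = x) (hvρ : ∀ x, Valued.v (ρ x) = Valued.v x) (hα : ρ α ≠ α) (hα1 : Valued.v α ≤ 1)
    (hint : ∀ z : M, Valued.v z ≤ 1 → Valued.v ((z - ρ z) / (α - ρ α)) ≤ 1)
    (hΘΘ : ∀ x, Θ (Θ x) = x) (hΘρ : ∀ x, Θ (ρ x) = ρ (Θ x)) (hvΘ : ∀ x, Valued.v (Θ x) = Valued.v x) (hΘj : ∀ c, Θ (jE c) = jE (σ c))
    (hjv : ∀ c, Valued.v (jE c) ≤ 1 ↔ Valued.v c ≤ 1) (hjiso : ∀ c, Valued.v (jE c) = Valued.v c) (hjfix : ∀ z, ρ z = z ↔ ∃ c, jE c = z)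
    (hjpow : ∀ (t : E) (n : ℤ), Valued.v (jE t) = Valued.v (jE ϖ) ^ n ↔ Valued.v t = Valued.v ϖ ^ n)
    (hϖmax : ∀ t : M, ρ t = t → Valued.v t < 1 → Valued.v t ≤ Valued.v (jE ϖ))
    (φ : (Fin 2 → E) →+ M) (hφs : ∀ (c : E) (x : Fin 2 → E), φ (c • x) = jE c * φ x) (hφi : Function.Injective φ) (hφo : Function.Surjective φ)
    {γ₂ : GL (Fin 2) E} {lam h : M} (hφγ : ∀ x, φ ((γ₂ : Matrix (Fin 2) (Fin 2) E).mulVec x) = lam * φ x) (hlam : Valued.v lam = 1)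
    (hΘh : Θ h = h) (hh : h ≠ 0) (hform : ∀ x y, jE (pairing σ H₂ x y) = h * Θ (φ x) * φ y + ρ (h * Θ (φ x) * φ y))
    (u : GL (Fin 1) E) {b j : ℕ} (hb1 : 1 ≤ b) (hbj : b < j) (hdb : d ≤ b) (hlamj : IsOrd ρ α (jE ϖ ^ j) lam)
    -- the LOWER-LINE letters in the cell currency `cc = ϖE^j`
    (hμle : Valued.v (lam - jE ((u : Matrix (Fin 1) (Fin 1) E) 0 0)) ≤ Valued.v (jE ϖ) ^ (2 * b + d % 2 + 1))
    (hanti : Valued.v ((lam - jE ((u : Matrix (Fin 1) (Fin 1) E) 0 0)) - ρ (lam - jE ((u : Matrix (Fin 1) (Fin 1) E) 0 0))) =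
      Valued.v (jE ϖ ^ j * (α - ρ α)) * Valued.v (jE ϖ) ^ (b + d % 2))
    (g1 : Valued.v (lam - jE ((u : Matrix (Fin 1) (Fin 1) E) 0 0)) * Valued.v (jE ϖ) ^ (d - 1) ≤
      Valued.v (α - ρ α) * Valued.v (jE ϖ) ^ b * Valued.v (jE ϖ) ^ mstarOfRecord d)
    (g2 : Valued.v (lam - jE ((u : Matrix (Fin 1) (Fin 1) E) 0 0)) * Valued.v (Θ α - α) ≤
      Valued.v (α - ρ α) * Valued.v (jE ϖ) ^ b * Valued.v (jE ϖ) ^ mstarOfRecord d)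
    (g3 : Valued.v (lam - jE ((u : Matrix (Fin 1) (Fin 1) E) 0 0)) * Valued.v (jE ϖ ^ j) ≤
      Valued.v (α - ρ α) * Valued.v (jE ϖ) ^ b * Valued.v (jE ϖ) ^ mstarOfRecord d)
    {n : ℕ} (hn : 3 * d - 2 + d % 2 ≤ n)
    (gsk : Valued.v (lam - jE ((u : Matrix (Fin 1) (Fin 1) E) 0 0)) * Valued.v ((lam - jE ((u : Matrix (Fin 1) (Fin 1) E) 0 0)) - ρ (lam - jE ((u : Matrix (Fin 1) (Fin 1) E) 0 0))) ≤
      Valued.v (jE ϖ) ^ n * Valued.v (jE ϖ ^ j * (α - ρ α)) * Valued.v (jE ϖ) ^ b)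
    (hΘlam : Θ lam * lam = 1) (hvlam : Valued.v lam = 1)
    (huu : ((u : Matrix (Fin 1) (Fin 1) E) 0 0) * σ ((u : Matrix (Fin 1) (Fin 1) E) 0 0) = 1)
    (hlamn : Valued.v (lam - 1) ≤ Valued.v (jE ϖ) ^ n) (hun : Valued.v ((u : Matrix (Fin 1) (Fin 1) E) 0 0 - 1) ≤ Valued.v ϖ ^ n)
    -- ★ (C1)'s weight letter
    (f : ℕ → ℕ → AddSubgroup M → ℕ)
    (hf : ∀ (b j : ℕ) (Λ : AddSubgroup M) (x₀ : M) (r : E), 1 ≤ b → x₀ ≠ 0 →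
      (∀ x, x ∈ Λ ↔ ∃ z, IsOrd ρ α (jE ϖ ^ j) z ∧ x = x₀ * z) →
      IsOrd ρ α (jE ϖ ^ j) (dualGen ρ Θ α (jE ϖ ^ j) h x₀) → ¬ IsOrd ρ α (jE ϖ ^ j) (dualGen ρ Θ α (jE ϖ ^ j) h x₀ / jE ϖ) →
      Valued.v (dualGen ρ Θ α (jE ϖ ^ j) h x₀) = Valued.v (jE ϖ) ^ b →
      (∀ b', (∀ x ∈ Λ, Valued.v (h * Θ x * b' + ρ (h * Θ x * b')) ≤ 1) → (lam - jE ((u : Matrix (Fin 1) (Fin 1) E) 0 0)) * b' ∈ Λ) →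
      IsOrd ρ α (jE ϖ ^ j) lam → jE r = glueUnit ρ Θ α (jE ϖ ^ j) h (jE ϖ) (jE hW) x₀ b →
      f b j Λ = Nat.card {x : 𝒪[E] ⧸ 𝓂[E] ^ (2 * b) // ∃ u' : 𝒪[E], Ideal.Quotient.mk (𝓂[E] ^ (2 * b)) u' = x ∧
        Valued.v ((u' : E) * σ u' - r) ≤ Valued.v (ϖ ^ (2 * b))})
    -- the product class
    (Pc : AddSubgroup M → Prop)
    (hPc : ∀ Λ, Pc Λ ↔ ∃ (x₀ : M) (r e₀ e' : E), x₀ ≠ 0 ∧ (∀ x, x ∈ Λ ↔ ∃ ζ, IsOrd ρ α (jE ϖ ^ j) ζ ∧ x = x₀ * ζ) ∧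
      IsOrd ρ α (jE ϖ ^ j) (dualGen ρ Θ α (jE ϖ ^ j) h x₀) ∧ ¬ IsOrd ρ α (jE ϖ ^ j) (dualGen ρ Θ α (jE ϖ ^ j) h x₀ / jE ϖ) ∧
      Valued.v (dualGen ρ Θ α (jE ϖ ^ j) h x₀) = Valued.v (jE ϖ) ^ b ∧
      σ r = r ∧ Valued.v r = 1 ∧ jE r = glueUnit ρ Θ α (jE ϖ ^ j) h (jE ϖ) (jE hW) x₀ b ∧
      jE e₀ = (lam - jE ((u : Matrix (Fin 1) (Fin 1) E) 0 0)) / (jE ϖ ^ j * (α - ρ α) * Θ (dualGen ρ Θ α (jE ϖ ^ j) h x₀)) +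
        ρ ((lam - jE ((u : Matrix (Fin 1) (Fin 1) E) 0 0)) / (jE ϖ ^ j * (α - ρ α) * Θ (dualGen ρ Θ α (jE ϖ ^ j) h x₀))) ∧
      σ e' = e' ∧ Valued.v e' = 1 ∧ Valued.v (e₀ - e' * ((ϖ - σ ϖ) * ((ϖ * σ ϖ) ^ ((d - d % 2) / 2))⁻¹)) ≤ Valued.v ϖ ^ mstarOfRecord d ∧
      ∃ c : E, c * σ c = r * e') :
    ∀ Λ ∈ levelSetDep ρ Θ α (jE ϖ) h j b (lam - jE ((u : Matrix (Fin 1) (Fin 1) E) 0 0)), f b j Λ ≠ 0 →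
      ∀ (B : Submodule 𝒪[E] (Fin 2 → E)) (L₃ : Submodule 𝒪[E] (Fin 3 → E)), B.toAddSubgroup.map φ = Λ →
        IsSelfDualLattice σ ϖ (!![H₂ 0 0, 0, H₂ 0 1; 0, hW, 0; H₂ 1 0, 0, H₂ 1 1] : Matrix (Fin 3) (Fin 3) E) L₃ →
        L₃ ⊓ LinearMap.ker ((LinearMap.proj (1 : Fin 3) : (Fin 3 → E) →ₗ[E] E).restrictScalars 𝒪[E]) =
          B.map ((Matrix.toLin' (!![1, 0; 0, 0; 0, 1] : Matrix (Fin 3) (Fin 2) E)).restrictScalars 𝒪[E]) →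
        (∀ c : E, (Pi.single 1 c : Fin 3 → E) ∈ L₃ ↔ Valued.v c ≤ Valued.v ϖ ^ b) →
        ({z : E | ∃ y ∈ L₃, Valued.v ((ϖ ^ mstarOfRecord d)⁻¹ * (z - pairing σ (!![H₂ 0 0, 0, H₂ 0 1; 0, hW, 0; H₂ 1 0, 0, H₂ 1 1] : Matrix (Fin 3) (Fin 3) E) y
            ((((endoGL (γ₂, u) : GL (Fin 3) E) : Matrix (Fin 3) (Fin 3) E) - 1) *ᵥ y))) ≤ 1} = valueSetMod σ ϖ (mstarOfRecord d) (xPlus σ ϖ d) ↔ Pc Λ) := by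
  haveI := Literature.NumberTheory.LocalFields.isAdicComplete_valuedInteger_of_completeSpace (K := E) hD.2.2.1
  have hd : Valued.v (ϖ - σ ϖ) = Valued.v ϖ ^ d := hD.2.2.2.2.1
  have hm : mstarOfRecord d = d % 2 + 2 * d - 1 := rfl
  have hvϖ0 : Valued.v ϖ ≠ 0 := by rw [hϖ]; exact exp_ne_zero
  have hϖ0 : ϖ ≠ 0 := fun h0 => hvϖ0 (by rw [h0, map_zero])
  have hϖlt : Valued.v ϖ < 1 := by rw [hϖ, ← exp_zero, exp_lt_exp]; norm_num
  have hjϖ0 : jE ϖ ≠ 0 := (map_ne_zero jE).2 hϖ0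
  have hjϖlt : Valued.v (jE ϖ) < 1 := (v_map_lt_one_iff_of_le_iff jE hjv ϖ).2 hϖlt
  have hρϖ : ρ (jE ϖ) = jE ϖ := (hjfix _).2 ⟨ϖ, rfl⟩
  have hα0 : α - ρ α ≠ 0 := sub_ne_zero.2 (Ne.symm hα)
  -- the cell letters `cc = ϖE^j`
  have hc : ρ (jE ϖ ^ j) = jE ϖ ^ j := by rw [map_pow, hρϖ]
  have hc0 : jE ϖ ^ j ≠ 0 := pow_ne_zero j hjϖ0
  have hc1 : Valued.v (jE ϖ ^ j) ≤ 1 := by rw [Valuation.map_pow]; exact pow_le_one₀ zero_le hjϖlt.le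
  have hcc : jE ϖ ^ j * (α - ρ α) ≠ 0 := mul_ne_zero hc0 hα0
  have hcb : Valued.v (jE ϖ ^ j) < Valued.v (jE ϖ) ^ b := by
    rw [Valuation.map_pow]; exact pow_lt_pow_right_of_lt_one₀ (zero_lt_iff.2 ((Valuation.ne_zero_iff _).2 hjϖ0)) hjϖlt hbj
  set H : Matrix (Fin 3) (Fin 3) E := !![H₂ 0 0, 0, H₂ 0 1; 0, hW, 0; H₂ 1 0, 0, H₂ 1 1] with hHdef
  set μ : M := lam - jE ((u : Matrix (Fin 1) (Fin 1) E) 0 0) with hμdef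
  set tp : E := (ϖ - σ ϖ) * ((ϖ * σ ϖ) ^ ((d - d % 2) / 2))⁻¹ with htp
  have hvt : Valued.v tp = Valued.v ϖ ^ (d % 2) := v_refSkew_eq hvσ hϖ hd
  have htp0 : tp ≠ 0 := fun h0 => by rw [h0, map_zero] at hvt; exact pow_ne_zero _ hvϖ0 hvt.symm
  -- the form is integral on a self-dual lattice
  have hintL : ∀ L : Submodule 𝒪[E] (Fin 3 → E), IsSelfDualLattice σ ϖ H L → ∀ y ∈ L, Valued.v (pairing σ H y y) ≤ 1 :=
    fun L hL y hy => (mem_dualLatt σ H L y).1 (le_dualLatt_of_isVertexLattice hvσ hL hy) y hy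
  intro Λ hΛ hfne B L₃ hBΛ hL hLB htube
  -- the ray unit of `L₃` on ANY presentation of `Λ`, for ANY ray scalar on it (★ p863761 through ★ p863923 §1's glue letters)
  have hray : ∀ (x₁ : M) (e₁ : E), x₁ ≠ 0 → (∀ x, x ∈ Λ ↔ ∃ ζ, IsOrd ρ α (jE ϖ ^ j) ζ ∧ x = x₁ * ζ) →
      IsOrd ρ α (jE ϖ ^ j) (dualGen ρ Θ α (jE ϖ ^ j) h x₁) → ¬ IsOrd ρ α (jE ϖ ^ j) (dualGen ρ Θ α (jE ϖ ^ j) h x₁ / jE ϖ) →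
      Valued.v (dualGen ρ Θ α (jE ϖ ^ j) h x₁) = Valued.v (jE ϖ) ^ b →
      jE e₁ = μ / (jE ϖ ^ j * (α - ρ α) * Θ (dualGen ρ Θ α (jE ϖ ^ j) h x₁)) + ρ (μ / (jE ϖ ^ j * (α - ρ α) * Θ (dualGen ρ Θ α (jE ϖ ^ j) h x₁))) →
      ∃ e'' : E, σ e'' = e'' ∧ Valued.v e'' = 1 ∧ Valued.v (e₁ - e'' * tp) ≤ Valued.v ϖ ^ mstarOfRecord d ∧
        {z : E | ∃ y ∈ L₃, Valued.v ((ϖ ^ mstarOfRecord d)⁻¹ * (z - pairing σ H y ((((endoGL (γ₂, u) : GL (Fin 3) E) : Matrix (Fin 3) (Fin 3) E) - 1) *ᵥ y))) ≤ 1} =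
          valueSetMod σ ϖ (mstarOfRecord d) (e'' • xPlus σ ϖ d) := by
    intro x₁ e₁ hx₁ hΛx₁ hyO₁ hyp₁ hylev₁ he₁
    obtain ⟨w₀, g₀, hw₀Y, hpr, hg₀, hg₀1, hprg⟩ := exists_glueLetters_of_gen σ hσ hvσ hϖ hH₂ hH₂σ hhW jE hρρ hvρ hα hα1 hint hΘΘ hΘρ hvΘ hjv hjfix hjpow hϖmax
      φ hφs hφi hφo hφγ hlam hΘh hh hform ((u : Matrix (Fin 1) (Fin 1) E) 0 0) hb1 hlamj hx₁ hΛx₁ hyO₁ hyp₁ hylev₁ hΛ.2 hBΛ hL hLB htube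
    exact exists_fixed_unit_valueSet_eq_smul_xPlus_of_line_sizes hD H₂ hW jE hjv hjiso hjfix hρρ hvρ hα hα1 hΘΘ hΘρ hvΘ hΘj φ hφs hφγ hh hΘh hform hpr (hintL L₃ hL) hLB.symm
      hg₀ hg₀1 hprg u hc hc0 hc1 hcc hx₁ hBΛ hΛx₁ hw₀Y hyO₁ hylev₁ hcb hμle hanti g1 g2 g3 hn gsk hΘlam hvlam huu he₁ hlamn hun
  -- two ray units of the SAME ray scalar are in the same class (★ (S0″) at `n = 2d − 1`)
  have hsame : ∀ (e₁ e' e'' : E), Valued.v (e₁ - e' * tp) ≤ Valued.v ϖ ^ mstarOfRecord d → Valued.v (e₁ - e'' * tp) ≤ Valued.v ϖ ^ mstarOfRecord d →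
      valueSetMod σ ϖ (mstarOfRecord d) (e'' • xPlus σ ϖ d) = valueSetMod σ ϖ (mstarOfRecord d) (e' • xPlus σ ϖ d) := by
    intro e₁ e' e'' h1 h2
    have hge : Valued.v (e'' - e') ≤ Valued.v ϖ ^ (2 * d - 1) := by
      have e : e'' - e' = tp⁻¹ * ((e₁ - e' * tp) - (e₁ - e'' * tp)) := by field_simp; ring
      rw [e, Valuation.map_mul, map_inv₀, hvt, inv_mul_le_iff₀ (pow_pos (zero_lt_iff.2 hvϖ0) _), ← pow_add,
        show d % 2 + (2 * d - 1) = mstarOfRecord d by rw [hm]; omega]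
      exact (Valuation.map_sub _ _ _).trans (max_le h1 h2)
    exact valueSetMod_smul_xPlus_eq_of_v_sub_le_pred hvσ hϖ hd (show mstarOfRecord d ≤ (2 * d - 1) + d % 2 from by rw [hm]; omega) hge
  constructor
  · -- (→) the canonical datum of the member is a norm (f ≠ 0 at d ≤ b) and the ray unit is a norm (label +)
    intro hVS
    obtain ⟨x₀, r₀, hx₀, hΛx, hyO, hyp, hylev, -, hσr₀, hr₀1, hr₀, hfΛ⟩ := exists_fixed_unit_weight_eq_natCard_normFibre σ hσ hvσ hϖ hH₂σ hhW hhWσ jE hρρ hvρ hα hα1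
      hint hΘΘ hΘρ hvΘ hΘj hjv hjfix hjpow hϖmax φ hφs hφi hφo hφγ hlam hΘh hh hform ((u : Matrix (Fin 1) (Fin 1) E) 0 0) hb1 hlamj f hf hΛ
    have hN₀ : ∃ e : E, e * σ e = r₀ := by
      by_contra hN
      exact hfne (hfΛ.trans (natCard_normFibre_eq_zero_of_not_exists_of_le hD hσr₀ hr₀1 hN hdb))
    -- a ray scalar on `x₀`
    have hfix : ρ (μ / (jE ϖ ^ j * (α - ρ α) * Θ (dualGen ρ Θ α (jE ϖ ^ j) h x₀)) + ρ (μ / (jE ϖ ^ j * (α - ρ α) * Θ (dualGen ρ Θ α (jE ϖ ^ j) h x₀)))) =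
        μ / (jE ϖ ^ j * (α - ρ α) * Θ (dualGen ρ Θ α (jE ϖ ^ j) h x₀)) + ρ (μ / (jE ϖ ^ j * (α - ρ α) * Θ (dualGen ρ Θ α (jE ϖ ^ j) h x₀))) := by
      rw [map_add, hρρ, add_comm]
    obtain ⟨e₀, he₀⟩ := (hjfix _).1 hfix
    obtain ⟨e', hσe', he'1, hclose, hVSe'⟩ := hray x₀ e₀ hx₀ hΛx hyO hyp hylev he₀
    have hNe' : ∃ z : E, z * σ z = e' := by
      rw [hVSe'] at hVS
      exact (valueSetMod_smul_xPlus_eq_plus_iff_exists_norm hD hσe' he'1).1 hVS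
    obtain ⟨c₁, hc₁⟩ := hN₀
    obtain ⟨c₂, hc₂⟩ := hNe'
    exact (hPc Λ).2 ⟨x₀, r₀, e₀, e', hx₀, hΛx, hyO, hyp, hylev, hσr₀, hr₀1, hr₀, he₀, hσe', he'1, hclose, c₁ * c₂,
      by rw [map_mul, show c₁ * c₂ * (σ c₁ * σ c₂) = (c₁ * σ c₁) * (c₂ * σ c₂) by ring, hc₁, hc₂]⟩
  · -- (←) the witness's `r` is a norm by ★ (C1)'s `hf` on the witness's own presentation, so `e′` is; the vertex's ray unit on that presentation is congruent to `e′`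
    intro hP
    obtain ⟨x₁, r₁, e₁, e', hx₁, hΛx₁, hyO₁, hyp₁, hylev₁, hσr₁, hr₁1, hr₁, he₁, hσe', he'1, hclose, c, hc⟩ := (hPc Λ).1 hP
    have hf₁ := hf b j Λ x₁ r₁ hb1 hx₁ hΛx₁ hyO₁ hyp₁ hylev₁ hΛ.2 hlamj hr₁
    have hN₁ : ∃ e : E, e * σ e = r₁ := by
      by_contra hN
      exact hfne (hf₁.trans (natCard_normFibre_eq_zero_of_not_exists_of_le hD hσr₁ hr₁1 hN hdb))
    have hr₁0 : r₁ ≠ 0 := fun h0 => by rw [h0, map_zero] at hr₁1; exact zero_ne_one hr₁1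
    have hNe' : ∃ z : E, z * σ z = e' := by
      obtain ⟨e, he⟩ := hN₁
      have he0 : e ≠ 0 := fun h0 => hr₁0 (by rw [← he, h0, zero_mul])
      refine ⟨c / e, ?_⟩
      rw [map_div₀, div_mul_div_comm, hc, he, mul_div_cancel_left₀ _ hr₁0]
    obtain ⟨e'', hσe'', he''1, hclose'', hVSe''⟩ := hray x₁ e₁ hx₁ hΛx₁ hyO₁ hyp₁ hylev₁ he₁
    rw [hVSe'', hsame e₁ e' e'' hclose hclose'']
    exact (valueSetMod_smul_xPlus_eq_plus_iff_exists_norm hD hσe' he'1).2 hNe'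

end Summit.HodgeConjecture.HodgeConjecture.Cruxes.H413.F0P3cDyRamLowerMixHiProductRead

end
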